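import Literature.MathematicalPhysics.QuantumLattice.HubbardUVSymbolSmooth
import Literature.MathematicalPhysics.QuantumLattice.HubbardSliceSymbolDifferences
import Literature.MathematicalPhysics.QuantumLattice.HubbardCovarianceCTNormalForm
import Literature.MathematicalPhysics.QuantumLattice.HubbardCTSliceGram
import Literature.Analysis.SpecialFunctions.MatsubaraSum
import HarnessLib

/-!
# Second differences of the padded ULTRAVIOLET symbol of the counterterm carrier on the space–time dual torus `(ℤ/N) × (ℤ/L)²`
# — the `ℓ²` inputs of the decay constant of the scale-`0` covariance on the `4M` grid, uniform in `M`, `β`, `L`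

Topic `MathematicalPhysics/QuantumLattice`; the ultraviolet / counterterm-frame twin of `HubbardSliceSymbolDifferences` (cell gate-hubbard-kl:
there the shifted SLICE symbol with the bare band; here the covariance ABOVE scale `Λ` of the CT carrier in a frame `K`,
`C^K_{>Λ} = hubbardCovAboveCT L M β μ 0 K Λ = normalCovariance (uvSymbolCT …)` by `hubbardCovAboveCT_zero_seed`, symbol
`w^K_Λ(k)·βL²/(-iω + e_K(k⃗))`).  Pulled back to the `N`-point time grid (`HubbardGridCharacters`, `2M ≤ N`) its padded symbol
`G(q₀,q⃗)` is `(βL²)⁻² Ψ_{e_K(q⃗)}(ω̃_{q₀})` for `val q₀ < 2M` and `0` beyond (`gridSymbol_uvSymbolCT_eq`; `Ψ = uvSymbolFn`, `HubbardUVSymbolSmooth`).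
Two differences with the slice case: (i) the symbol does NOT vanish at the top frequencies, so the padding is a genuine JUMP — the second time
differences at the four EDGE points `val q₀ ∈ {2M-2, 2M-1, N-2, N-1}` are bounded by the edge values `4(βL²)⁻¹·β/(π(2M-3))` (small in `M`, no
smoothness used), all other non-interior ones vanish; (ii) nothing is compactly supported, so the `ℓ²` sums are genuine Matsubara sums
`Σ_i max(|ω_i|, Λ/2)^{-2p} ≤ (2/Λ)^{2p-2}·2β/Λ` (`sum_inv_uvEnv_sq_le`, from `tsum_one_div_matsubara_sq_add_sq`), uniform in `M`.
The band direction runs along lattice lines of the continuum frame band `e_K(p) = -2(cos p₁ + cos p₂) - μ - K(p)` (`ctBandFn`, periodic: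
`nambuXiCT_add_smul_single_eq_ctLine`), whose first two derivatives along the line are ASSUMED bounded by `D` (hypothesis `UVLineBound`;
discharged Summits-side from `FrameOK`).

Main results (for `G = gridSymbol L M N β (uvSymbolCT L M β μ K Λ) σ`, `u = 1 ∈ (ℤ/N)¹`, `e_l` the unit vectors of `(ℤ/L)²`):
* `uvSymbolCT`, `hubbardCovAboveCT_zero_seed_eq_normalCovariance_uvSymbolCT`, `uvSymbolCT_eq_uvSymbolFn`, `gridSymbol_uvSymbolCT_eq`, `norm_gridSymbol_uvSymbolCT_le`;
* `sum_matsubaraIdx_inv_sq_add_sq_le` (`Σ_i 1/(ω_i²+a²) ≤ β/(2a)`), `sum_inv_uvEnv_pow_le`;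
* time: `fwdDiff_two_time_gridSymbol_uvSymbolCT_eq` (interior), `norm_fwdDiff_two_time_…_le_interior`, `…_le_edge`, `…_eq_zero_of_padding`,
  **`sum_norm_sq_fwdDiff_two_time_uvSymbolCT_le`**;
* space: `ctBandFn`, `ctLine`, `UVLineBound`, `nambuXiCT_add_smul_single_eq_ctLine`, `fwdDiff_two_space_gridSymbol_uvSymbolCT_eq`,
  **`sum_norm_sq_fwdDiff_two_space_uvSymbolCT_le`**;
* **`sum_norm_sq_gridSymbol_uvSymbolCT_le`**.

Everything is proved; `uvSymbolCT`, `ctBandFn`, `ctLine`, `UVLineBound` are the only definitions; no named facts.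

## Sources

G. Benfatto, A. Giuliani, V. Mastropietro, Ann. Henri Poincaré 7 (2006) 809–898, §2.1 (2.3), (2.36aa), footnote ¹, App. A1
(`BenfattoGiulianiMastropietro2006`); M. Salmhofer, *Renormalization* (1999), §4.2.4–4.2.5 (4.63), (4.70) (`Salmhofer1999`);
W. de Siqueira Pedra, M. Salmhofer, Comm. Math. Phys. 282 (2008) 797–818, §4 Cor. 4.4 (`PedraSalmhofer2008`).
-/

noncomputable section

namespace Literature.MathematicalPhysics.QuantumLattice

open Literature.Probability.LatticeModels Literature.Analysis.SpecialFunctions Finset Complex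

variable {L M N : ℕ}

/-! ### The ultraviolet symbol of the CT carrier and its padded grid symbol -/

variable (L M) in
/-- **The symbol of `C^K_{>Λ}` at zero seed**: `w^K_Λ(k)·βL²·(iω + e_K)/(ω² + e_K²)` (the normal form of
`HubbardCovarianceCTNormalForm.hubbardCovAboveCT_zero_seed`). [cite: Salmhofer1999, §4.2.5 (4.70)] -/
def uvSymbolCT [NeZero L] (β μ : ℝ) (K : TrigPolyC4v) (Λ : ℝ) (ks : FreqMomentum L M × Fin 2) : ℂ :=
  (hubbardCutoffWeightCT L M β μ K Λ ks.1 : ℂ) *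
    (((β * (L : ℝ) ^ 2 : ℝ) : ℂ) * ((Complex.I * matsubaraFreq β M ks.1.1 + nambuXiCT L μ K ks.1.2) / nambuDenCT L M β μ 0 K ks.1))

section Symbol

variable [NeZero L]

/-- `C^K_{>Λ}` at seed `0` is the normal covariance of `uvSymbolCT`. [cite: Salmhofer1999, §4.2.5 (4.70)] -/
theorem hubbardCovAboveCT_zero_seed_eq_normalCovariance_uvSymbolCT (β μ : ℝ) (K : TrigPolyC4v) (Λ : ℝ) :
    hubbardCovAboveCT L M β μ 0 K Λ = normalCovariance L M (uvSymbolCT L M β μ K Λ) :=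
  hubbardCovAboveCT_zero_seed β μ K Λ

/-- **The lattice symbol is the restriction of the continuum one**: `uvSymbolCT((i,k⃗),σ) = Ψ_{e_K(k⃗)}(ω_i)` with `c = βL²`
(`0 < β`: the fermionic frequencies are nonzero). [cite: Salmhofer1999, §4.2.5 (4.70)] -/
theorem uvSymbolCT_eq_uvSymbolFn {β : ℝ} (hβ : 0 < β) (μ : ℝ) (K : TrigPolyC4v) (Λ : ℝ) (i : MatsubaraIdx M)
    (kv : TorusSite 2 L) (σ : Fin 2) :
    uvSymbolCT L M β μ K Λ ((i, kv), σ) = uvSymbolFn (β * (L : ℝ) ^ 2) Λ (nambuXiCT L μ K kv) (matsubaraFreq β M i) := by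
  set ω := matsubaraFreq β M i with hω
  set e := nambuXiCT L μ K kv with he
  have hω0 : ω ≠ 0 := by
    intro h0
    have h1 := pi_div_le_abs_matsubaraFreq hβ i
    rw [← hω, h0, abs_zero] at h1
    exact absurd h1 (not_le.2 (by positivity))
  have hd : ((ω : ℂ) ^ 2 + (e : ℂ) ^ 2) ≠ 0 := by
    have : 0 < ω ^ 2 + e ^ 2 := by positivity
    exact_mod_cast this.ne'
  have hden : (-I * ((ω : ℂ) + 0) + (e : ℂ)) ≠ 0 := by
    intro h0
    have hn := norm_sq_uvDen e ω
    push_cast at hn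
    rw [h0, norm_zero] at hn
    have : 0 < ω ^ 2 + e ^ 2 := by positivity
    nlinarith
  have key : (I * (ω : ℂ) + (e : ℂ)) / ((ω : ℂ) ^ 2 + (e : ℂ) ^ 2) = 1 / (-I * ((ω : ℂ) + 0) + (e : ℂ)) := by
    rw [div_eq_div_iff hd hden]
    ring_nf
    rw [Complex.I_sq]
    ring
  unfold uvSymbolCT uvSymbolFn uvWeightFn resolventFn hubbardCutoffWeightCT
  simp only []
  rw [nambuDenCT_zero_seed, ← hω, ← he]
  push_cast
  rw [key]
  ring

/-- **The padded grid symbol of `C^K_{>Λ}`**: `(βL²)⁻² Ψ_{e_K(q⃗)}(ω̃_{q₀})` if `val q₀ < 2M`, else `0`. [cite: BenfattoGiulianiMastropietro2006, §2.1 (2.3)] -/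
theorem gridSymbol_uvSymbolCT_eq {β : ℝ} (hβ : 0 < β) (μ : ℝ) (K : TrigPolyC4v) (Λ : ℝ) (σ : Fin 2) (q₀ : TorusSite 1 N)
    (qv : TorusSite 2 L) :
    gridSymbol L M N β (uvSymbolCT L M β μ K Λ) σ q₀ qv =
      if (q₀ 0).val < 2 * M then ((1 / (β * (L : ℝ) ^ 2) : ℝ) : ℂ) ^ 2 *
        uvSymbolFn (β * (L : ℝ) ^ 2) Λ (nambuXiCT L μ K qv) (gridFreq M N β q₀) else 0 := by
  unfold gridSymbol
  split_ifs with h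
  · rw [uvSymbolCT_eq_uvSymbolFn hβ, matsubaraFreq_eq_gridFreq β q₀ h]
  · rfl

/-- **`‖G(q₀,q⃗)‖ ≤ (βL²)⁻²·βL²/max(|ω̃_{q₀}|, Λ/2)`** for every `q₀` (`0 < β`, `0 < Λ`). [cite: BenfattoGiulianiMastropietro2006, §2.1 (2.3)] -/
theorem norm_gridSymbol_uvSymbolCT_le {β : ℝ} (hβ : 0 < β) (μ : ℝ) (K : TrigPolyC4v) {Λ : ℝ} (hΛ : 0 < Λ) (σ : Fin 2)
    (q₀ : TorusSite 1 N) (qv : TorusSite 2 L) :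
    ‖gridSymbol L M N β (uvSymbolCT L M β μ K Λ) σ q₀ qv‖ ≤
      (1 / (β * (L : ℝ) ^ 2)) ^ 2 * ((β * (L : ℝ) ^ 2) / max |gridFreq M N β q₀| (Λ / 2)) := by
  rw [gridSymbol_uvSymbolCT_eq hβ]
  split_ifs with h
  · rw [norm_mul, norm_pow, Complex.norm_real, Real.norm_eq_abs, abs_of_nonneg (by positivity)]
    exact mul_le_mul_of_nonneg_left (norm_uvSymbolFn_le hΛ (by positivity) _) (by positivity)
  · rw [norm_zero]
    exact mul_nonneg (by positivity) (div_nonneg (by positivity) (uvEnv_pos hΛ _).le)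

end Symbol

/-! ### Matsubara sums of the envelope -/

/-- **`Σ_i 1/(ω_i² + a²) ≤ β/(2a)`** over the `2M` truncated fermionic frequencies (`0 < β`, `0 < a`): the one-sided partial sum is below
`Σ_{n≥0} = β tanh(βa/2)/(4a)`. [cite: BenfattoGiulianiMastropietro2006, §2.1 (2.2)–(2.5)] -/
theorem sum_matsubaraIdx_inv_sq_add_sq_le {β a : ℝ} (hβ : 0 < β) (ha : 0 < a) (M : ℕ) :
    ∑ i : MatsubaraIdx M, 1 / (matsubaraFreq β M i ^ 2 + a ^ 2) ≤ β / (2 * a) := by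
  rw [sum_matsubaraIdx_one_div_sq_add_sq]
  have hs := summable_one_div_matsubara_sq_add_sq hβ a
  have hle := hs.sum_le_tsum (Finset.range M) (fun n _ => by positivity)
  rw [tsum_one_div_matsubara_sq_add_sq hβ ha.ne'] at hle
  have ht : Real.tanh (β * a / 2) ≤ 1 := (Real.tanh_lt_one _).le
  calc 2 * ∑ n ∈ Finset.range M, 1 / ((((2 * n + 1) * Real.pi / β) ^ 2 + a ^ 2)) ≤ 2 * (β * Real.tanh (β * a / 2) / (4 * a)) := by
        linarith
    _ ≤ 2 * (β * 1 / (4 * a)) := by gcongr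
    _ = β / (2 * a) := by ring

/-- **`Σ_i max(|ω_i|, Λ/2)^{-(2p+2)} ≤ (2/Λ)^{2p}·2β/Λ`** (`0 < β`, `0 < Λ`): the envelope sums are `O(β/Λ^{2p+1})`, uniformly in `M`.
[cite: BenfattoGiulianiMastropietro2006, §2.1 (2.2)–(2.5)] -/
theorem sum_inv_uvEnv_pow_le {β Λ : ℝ} (hβ : 0 < β) (hΛ : 0 < Λ) (M p : ℕ) :
    ∑ i : MatsubaraIdx M, 1 / max |matsubaraFreq β M i| (Λ / 2) ^ (2 * p + 2) ≤ (2 / Λ) ^ (2 * p) * (2 * β / Λ) := by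
  have hterm : ∀ i : MatsubaraIdx M, 1 / max |matsubaraFreq β M i| (Λ / 2) ^ (2 * p + 2) ≤
      (2 / Λ) ^ (2 * p) * (2 * (1 / (matsubaraFreq β M i ^ 2 + (Λ / 2) ^ 2))) := by
    intro i
    set m := max |matsubaraFreq β M i| (Λ / 2) with hm
    have hm0 : 0 < m := uvEnv_pos hΛ _
    have hmΛ : Λ / 2 ≤ m := le_max_right _ _
    have hmω : |matsubaraFreq β M i| ≤ m := le_max_left _ _
    have hω2 : matsubaraFreq β M i ^ 2 ≤ m ^ 2 := by
      rw [← sq_abs]; exact pow_le_pow_left₀ (abs_nonneg _) hmω 2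
    have hΛ2 : (Λ / 2) ^ 2 ≤ m ^ 2 := pow_le_pow_left₀ (by positivity) hmΛ 2
    have h1 : 1 / m ^ (2 * p + 2) = (1 / m ^ 2) ^ p * (1 / m ^ 2) := by
      rw [pow_add, pow_mul, one_div_pow, div_mul_div_comm, one_mul]
    have h2 : 1 / m ^ 2 ≤ (2 / Λ) ^ 2 := by
      rw [div_pow, div_le_div_iff₀ (by positivity) (by positivity)]
      nlinarith
    have h3 : 1 / m ^ 2 ≤ 2 * (1 / (matsubaraFreq β M i ^ 2 + (Λ / 2) ^ 2)) := by
      rw [mul_one_div, div_le_div_iff₀ (by positivity) (by positivity)]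
      nlinarith
    rw [h1, pow_mul]
    exact mul_le_mul (pow_le_pow_left₀ (by positivity) h2 p) h3 (by positivity) (by positivity)
  refine (sum_le_sum fun i _ => hterm i).trans ?_
  rw [← mul_sum, ← mul_sum]
  refine mul_le_mul_of_nonneg_left ?_ (by positivity)
  have h := sum_matsubaraIdx_inv_sq_add_sq_le hβ (show 0 < Λ / 2 by positivity) M
  calc 2 * ∑ i : MatsubaraIdx M, 1 / (matsubaraFreq β M i ^ 2 + (Λ / 2) ^ 2) ≤ 2 * (β / (2 * (Λ / 2))) := by linarith
    _ = 2 * β / Λ := by field_simp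

/-- **The shifted envelope against the envelope**: for `|ω| ≥ π/β`,
`max(|ω| - 4π/β, Λ/2)^{-6} ≤ 64·max(|ω|, Λ/2)^{-6} + (2/Λ)⁶·(8π/β)²·2/(ω² + (π/β)²)` (if `|ω| ≥ 8π/β` the shift costs a factor `2`;
the at most eight smaller frequencies are paid by `(8π/β)²·2/(ω²+(π/β)²) ≥ 1`). [cite: BenfattoGiulianiMastropietro2006, (2.36aa)] -/
theorem inv_uvEnvShift_pow_six_le {β Λ : ℝ} (hβ : 0 < β) (hΛ : 0 < Λ) (ω : ℝ) :
    1 / max (|ω| - 2 * (2 * Real.pi / β)) (Λ / 2) ^ 6 ≤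
      64 / max |ω| (Λ / 2) ^ 6 + (2 / Λ) ^ 6 * ((8 * Real.pi / β) ^ 2 * (2 / (ω ^ 2 + (Real.pi / β) ^ 2))) := by
  have hm := uvEnv_pos hΛ ω
  have hms : 0 < max (|ω| - 2 * (2 * Real.pi / β)) (Λ / 2) := lt_max_of_lt_right (by positivity)
  have hπβ : 0 < Real.pi / β := by positivity
  have hB : 0 ≤ (2 / Λ) ^ 6 * ((8 * Real.pi / β) ^ 2 * (2 / (ω ^ 2 + (Real.pi / β) ^ 2))) := by positivity
  by_cases h8 : 8 * Real.pi / β ≤ |ω|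
  · -- `max(|ω|,Λ/2) ≤ 2·max(|ω| - 4π/β, Λ/2)`
    have hcmp : max |ω| (Λ / 2) ≤ 2 * max (|ω| - 2 * (2 * Real.pi / β)) (Λ / 2) := by
      refine max_le ?_ ?_
      · have : |ω| - 2 * (2 * Real.pi / β) ≥ |ω| / 2 := by
          have : 2 * (2 * Real.pi / β) = (8 * Real.pi / β) / 2 := by ring
          linarith
        linarith [le_max_left (|ω| - 2 * (2 * Real.pi / β)) (Λ / 2)]
      · linarith [le_max_right (|ω| - 2 * (2 * Real.pi / β)) (Λ / 2)]
    have h6 : max |ω| (Λ / 2) ^ 6 ≤ 64 * max (|ω| - 2 * (2 * Real.pi / β)) (Λ / 2) ^ 6 := by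
      have := pow_le_pow_left₀ hm.le hcmp 6
      rw [mul_pow] at this
      norm_num at this
      linarith
    calc 1 / max (|ω| - 2 * (2 * Real.pi / β)) (Λ / 2) ^ 6 ≤ 64 / max |ω| (Λ / 2) ^ 6 := by
          rw [div_le_div_iff₀ (by positivity) (by positivity)]; linarith
      _ ≤ _ := le_add_of_nonneg_right hB
  · -- few small frequencies: the second term alone is at least `(2/Λ)⁶`
    have h1 : 1 / max (|ω| - 2 * (2 * Real.pi / β)) (Λ / 2) ^ 6 ≤ (2 / Λ) ^ 6 := by
      rw [div_pow, div_le_div_iff₀ (by positivity) (by positivity), one_mul]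
      have : (Λ / 2) ^ 6 ≤ max (|ω| - 2 * (2 * Real.pi / β)) (Λ / 2) ^ 6 :=
        pow_le_pow_left₀ (by positivity) (le_max_right _ _) 6
      nlinarith
    have h2 : 1 ≤ (8 * Real.pi / β) ^ 2 * (2 / (ω ^ 2 + (Real.pi / β) ^ 2)) := by
      rw [not_le] at h8
      have hω2 : ω ^ 2 < (8 * Real.pi / β) ^ 2 := by
        rw [← sq_abs]; exact pow_lt_pow_left₀ h8 (abs_nonneg _) two_ne_zero
      have hπβ2 : (Real.pi / β) ^ 2 ≤ (8 * Real.pi / β) ^ 2 := by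
        apply pow_le_pow_left₀ hπβ.le; rw [div_le_div_iff₀ hβ hβ]; nlinarith [Real.pi_pos]
      rw [← mul_div_assoc, le_div_iff₀ (by positivity)]
      nlinarith
    have hA : 0 ≤ 64 / max |ω| (Λ / 2) ^ 6 := by positivity
    calc 1 / max (|ω| - 2 * (2 * Real.pi / β)) (Λ / 2) ^ 6 ≤ (2 / Λ) ^ 6 * 1 := by rw [mul_one]; exact h1
      _ ≤ (2 / Λ) ^ 6 * ((8 * Real.pi / β) ^ 2 * (2 / (ω ^ 2 + (Real.pi / β) ^ 2))) :=
          mul_le_mul_of_nonneg_left h2 (by positivity)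
      _ ≤ _ := le_add_of_nonneg_left hA

/-- **`Σ_i max(|ω_i| - 4π/β, Λ/2)^{-6} ≤ 64·(2/Λ)⁴·2β/Λ + (2/Λ)⁶·64π`** (`0 < β`, `0 < Λ`): the shifted-envelope sum of the interior time
differences, uniform in `M`. [cite: BenfattoGiulianiMastropietro2006, §2.1 (2.2)–(2.5)] -/
theorem sum_inv_uvEnvShift_pow_six_le {β Λ : ℝ} (hβ : 0 < β) (hΛ : 0 < Λ) (M : ℕ) :
    ∑ i : MatsubaraIdx M, 1 / max (|matsubaraFreq β M i| - 2 * (2 * Real.pi / β)) (Λ / 2) ^ 6 ≤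
      64 * ((2 / Λ) ^ 4 * (2 * β / Λ)) + (2 / Λ) ^ 6 * (64 * Real.pi) := by
  have hterm := fun i : MatsubaraIdx M => inv_uvEnvShift_pow_six_le hβ hΛ (matsubaraFreq β M i)
  refine (sum_le_sum fun i _ => hterm i).trans ?_
  rw [sum_add_distrib, ← mul_sum, ← mul_sum]
  refine add_le_add ?_ ?_
  · have h := sum_inv_uvEnv_pow_le hβ hΛ M 2
    have : ∑ i : MatsubaraIdx M, 64 / max |matsubaraFreq β M i| (Λ / 2) ^ 6 =
        64 * ∑ i : MatsubaraIdx M, 1 / max |matsubaraFreq β M i| (Λ / 2) ^ (2 * 2 + 2) := by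
      rw [mul_sum]; exact sum_congr rfl fun i _ => by rw [show 2 * 2 + 2 = 6 by norm_num]; ring
    rw [this]
    exact mul_le_mul_of_nonneg_left h (by norm_num)
  · refine mul_le_mul_of_nonneg_left ?_ (by positivity)
    have h := sum_matsubaraIdx_inv_sq_add_sq_le hβ (show 0 < Real.pi / β by positivity) M
    have h2 : ∑ i : MatsubaraIdx M, 2 / (matsubaraFreq β M i ^ 2 + (Real.pi / β) ^ 2) ≤ 2 * (β / (2 * (Real.pi / β))) := by
      rw [show (∑ i : MatsubaraIdx M, 2 / (matsubaraFreq β M i ^ 2 + (Real.pi / β) ^ 2)) =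
          2 * ∑ i : MatsubaraIdx M, 1 / (matsubaraFreq β M i ^ 2 + (Real.pi / β) ^ 2) by
        rw [mul_sum]; exact sum_congr rfl fun i _ => by ring]
      linarith
    calc (8 * Real.pi / β) ^ 2 * ∑ i : MatsubaraIdx M, 2 / (matsubaraFreq β M i ^ 2 + (Real.pi / β) ^ 2)
        ≤ (8 * Real.pi / β) ^ 2 * (2 * (β / (2 * (Real.pi / β)))) := mul_le_mul_of_nonneg_left h2 (by positivity)
      _ = 64 * Real.pi := by field_simp; ring

/-! ### The time direction: interior second differences, the four edge points, the padding -/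

section Time

variable [NeZero L] [NeZero N] {β μ Λ : ℝ} {K : TrigPolyC4v}

omit [NeZero L] in
/-- The value of a translate along the time step: `val(q₀ + m·1) = (val q₀ + m) mod N` (`m < N`). [cite: Salmhofer1999, §4.2.4 (4.63)] -/
theorem val_add_smul_timeStep (q₀ : TorusSite 1 N) {m : ℕ} (hm : m < N) :
    ((q₀ + m • (fun _ : Fin 1 => (1 : ZMod N))) 0).val = ((q₀ 0).val + m) % N := by
  rw [Pi.add_apply, smul_const_one_apply, ZMod.val_add, ZMod.val_natCast, Nat.mod_eq_of_lt hm]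

/-- **The second time difference of the padded symbol in the interior** (`val q₀ + 2 < 2M ≤ N`):
`(Δ_u)² G(·,q⃗)(q₀) = (βL²)⁻² [Ψ(ω̃+2δ) - 2Ψ(ω̃+δ) + Ψ(ω̃)]`, `δ = 2π/β`, `ω̃ = ω̃_{q₀}`. [cite: BenfattoGiulianiMastropietro2006, (2.36aa)] -/
theorem fwdDiff_two_time_gridSymbol_uvSymbolCT_eq (hβ : 0 < β) (hMN : 2 * M ≤ N) (σ : Fin 2) (q₀ : TorusSite 1 N)
    (qv : TorusSite 2 L) (h : (q₀ 0).val + 2 < 2 * M) :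
    (fwdDiff (fun _ : Fin 1 => (1 : ZMod N)))^[2] (fun q => gridSymbol L M N β (uvSymbolCT L M β μ K Λ) σ q qv) q₀ =
      ((1 / (β * (L : ℝ) ^ 2) : ℝ) : ℂ) ^ 2 *
        (uvSymbolFn (β * (L : ℝ) ^ 2) Λ (nambuXiCT L μ K qv) (gridFreq M N β q₀ + 2 * (2 * Real.pi / β)) -
          (2 : ℝ) • uvSymbolFn (β * (L : ℝ) ^ 2) Λ (nambuXiCT L μ K qv) (gridFreq M N β q₀ + 2 * Real.pi / β) +
          uvSymbolFn (β * (L : ℝ) ^ 2) Λ (nambuXiCT L μ K qv) (gridFreq M N β q₀)) := by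
  have h0 : (q₀ 0).val < 2 * M := by omega
  have h1N : (q₀ 0).val + 1 < N := by omega
  have h2N : (q₀ 0).val + 2 < N := by omega
  have hv1 : ((q₀ + 1 • (fun _ : Fin 1 => (1 : ZMod N))) 0).val < 2 * M := by
    rw [val_add_smul_timeStep q₀ (by omega), Nat.mod_eq_of_lt h1N]; omega
  have hv2 : ((q₀ + 2 • (fun _ : Fin 1 => (1 : ZMod N))) 0).val < 2 * M := by
    rw [val_add_smul_timeStep q₀ (by omega), Nat.mod_eq_of_lt h2N]; omega
  rw [fwdDiff_iter_two_apply, gridSymbol_uvSymbolCT_eq hβ, gridSymbol_uvSymbolCT_eq hβ, gridSymbol_uvSymbolCT_eq hβ,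
    if_pos hv2, if_pos hv1, if_pos h0, gridFreq_add_smul β q₀ 2 h2N, gridFreq_add_smul β q₀ 1 h1N]
  push_cast
  rw [one_mul, Complex.real_smul]
  push_cast
  ring

/-- **Interior bound**: `‖(Δ_u)² G(·,q⃗)(q₀)‖ ≤ (βL²)⁻²·(2π/β)²·(4B₂+6B₁+2)·βL²/max(|ω̃| - 4π/β, Λ/2)³` for `val q₀ + 2 < 2M ≤ N` (mean value twice,
`norm_second_difference_le`, against the envelope shifted by the two steps). [cite: BenfattoGiulianiMastropietro2006, (2.36aa)] -/
theorem norm_fwdDiff_two_time_gridSymbol_uvSymbolCT_le_interior (hβ : 0 < β) (hΛ : 0 < Λ) {B₁ B₂ : ℝ}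
    (hB₁ : ∀ x, |deriv salmhoferCutoff x| ≤ B₁) (hB₂ : ∀ x, |deriv (deriv salmhoferCutoff) x| ≤ B₂) (hMN : 2 * M ≤ N)
    (σ : Fin 2) (q₀ : TorusSite 1 N) (qv : TorusSite 2 L) (h : (q₀ 0).val + 2 < 2 * M) :
    ‖(fwdDiff (fun _ : Fin 1 => (1 : ZMod N)))^[2] (fun q => gridSymbol L M N β (uvSymbolCT L M β μ K Λ) σ q qv) q₀‖ ≤
      (1 / (β * (L : ℝ) ^ 2)) ^ 2 * ((2 * Real.pi / β) ^ 2 *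
        ((4 * B₂ + 6 * B₁ + 2) * (β * (L : ℝ) ^ 2) / max (|gridFreq M N β q₀| - 2 * (2 * Real.pi / β)) (Λ / 2) ^ 3)) := by
  set ω := gridFreq M N β q₀ with hω
  set c := β * (L : ℝ) ^ 2 with hc
  set e := nambuXiCT L μ K qv with he
  have hc0 : 0 ≤ c := by positivity
  have hms : 0 < max (|ω| - 2 * (2 * Real.pi / β)) (Λ / 2) := lt_max_of_lt_right (by positivity)
  rw [fwdDiff_two_time_gridSymbol_uvSymbolCT_eq hβ hMN σ q₀ qv h, norm_mul, norm_pow, Complex.norm_real, Real.norm_eq_abs,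
    abs_of_nonneg (by positivity), ← hω, ← hc, ← he]
  refine mul_le_mul_of_nonneg_left ?_ (by positivity)
  refine Literature.Analysis.norm_second_difference_le (δ := 2 * Real.pi / β) (by positivity)
    (fun t _ => hasDerivAt_uvSymbolFn (c := c) (e := e) hΛ t) (fun t _ => hasDerivAt_uvSymbolFnD1 (c := c) (e := e) hΛ t)
    fun t ht => ?_
  -- on `[ω, ω + 2δ]`: `max(|t|, Λ/2) ≥ max(|ω| - 2δ, Λ/2)`
  have hmt : max (|ω| - 2 * (2 * Real.pi / β)) (Λ / 2) ≤ max |t| (Λ / 2) := by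
    refine max_le_max ?_ le_rfl
    have h1 : |ω| ≤ |t| + |ω - t| := by
      have := abs_add_le t (ω - t); rwa [add_sub_cancel] at this
    have h2 : |ω - t| ≤ 2 * (2 * Real.pi / β) := by
      rw [abs_sub_comm, abs_of_nonneg (by linarith [ht.1])]; linarith [ht.2]
    linarith
  refine (norm_uvSymbolFnD2_le hΛ hc0 hB₁ hB₂ t).trans ?_
  have hB : 0 ≤ (4 * B₂ + 6 * B₁ + 2) * c := by
    have hB10 : 0 ≤ B₁ := (abs_nonneg _).trans (hB₁ 0)
    have hB20 : 0 ≤ B₂ := (abs_nonneg _).trans (hB₂ 0)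
    positivity
  exact div_le_div_of_nonneg_left hB (pow_pos hms 3) (pow_le_pow_left₀ hms.le hmt 3)

omit [NeZero N] in
/-- **At the edge frequencies** (`val q₀ ≤ 1` or `2M-2 ≤ val q₀`, `2 ≤ M`) the padded symbol is small:
`‖G(q₀,q⃗)‖ ≤ (βL²)⁻²·βL²·β/(π(2M-3))` (it vanishes if `val q₀ ≥ 2M`, and `|ω̃| ≥ π(2M-3)/β` otherwise).
[cite: BenfattoGiulianiMastropietro2006, §2.1 (2.3)] -/
theorem norm_gridSymbol_uvSymbolCT_le_edge (hβ : 0 < β) (hΛ : 0 < Λ) (hM : 2 ≤ M) (σ : Fin 2) (q₀ : TorusSite 1 N) (qv : TorusSite 2 L)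
    (hq : (q₀ 0).val ≤ 1 ∨ 2 * M - 2 ≤ (q₀ 0).val) :
    ‖gridSymbol L M N β (uvSymbolCT L M β μ K Λ) σ q₀ qv‖ ≤
      (1 / (β * (L : ℝ) ^ 2)) ^ 2 * ((β * (L : ℝ) ^ 2) * (β / (Real.pi * (2 * M - 3)))) := by
  have hM' : (0 : ℝ) < 2 * M - 3 := by
    have : (2 : ℝ) ≤ M := by exact_mod_cast hM
    linarith
  have hfreq := abs_gridFreq_ge (M := M) hβ q₀ hq
  have hpos : 0 < Real.pi * (2 * M - 3) / β := by positivity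
  refine (norm_gridSymbol_uvSymbolCT_le hβ μ K hΛ σ q₀ qv).trans (mul_le_mul_of_nonneg_left ?_ (by positivity))
  rw [div_eq_mul_one_div]
  refine mul_le_mul_of_nonneg_left ?_ (by positivity)
  rw [one_div_le (uvEnv_pos hΛ _) (by positivity), one_div_div]
  exact hfreq.trans (le_max_left _ _)

/-- **The non-interior second time differences are edge-sized**: for `2M ≤ val q₀ + 2` (`2 ≤ M`, `2M ≤ N`) the three points `q₀, q₀+u, q₀+2u`
have indices `≥ 2M-2` or (wrapped) `≤ 1`, so `‖(Δ_u)² G(·,q⃗)(q₀)‖ ≤ 4·(βL²)⁻²·βL²·β/(π(2M-3))`. [cite: BenfattoGiulianiMastropietro2006, (2.36aa)] -/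
theorem norm_fwdDiff_two_time_gridSymbol_uvSymbolCT_le_edge (hβ : 0 < β) (hΛ : 0 < Λ) (hM : 2 ≤ M) (hMN : 2 * M ≤ N) (σ : Fin 2)
    (q₀ : TorusSite 1 N) (qv : TorusSite 2 L) (h : 2 * M ≤ (q₀ 0).val + 2) :
    ‖(fwdDiff (fun _ : Fin 1 => (1 : ZMod N)))^[2] (fun q => gridSymbol L M N β (uvSymbolCT L M β μ K Λ) σ q qv) q₀‖ ≤
      4 * ((1 / (β * (L : ℝ) ^ 2)) ^ 2 * ((β * (L : ℝ) ^ 2) * (β / (Real.pi * (2 * M - 3))))) := by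
  set E := (1 / (β * (L : ℝ) ^ 2)) ^ 2 * ((β * (L : ℝ) ^ 2) * (β / (Real.pi * (2 * M - 3)))) with hE
  have hval : ∀ m : ℕ, m ≤ 2 → ((q₀ + m • (fun _ : Fin 1 => (1 : ZMod N))) 0).val ≤ 1 ∨
      2 * M - 2 ≤ ((q₀ + m • (fun _ : Fin 1 => (1 : ZMod N))) 0).val := by
    intro m hm
    have hmN : m < N := by omega
    have hv := (q₀ 0).val_lt
    rw [val_add_smul_timeStep q₀ hmN]
    by_cases hlt : (q₀ 0).val + m < N
    · rw [Nat.mod_eq_of_lt hlt]; right; omega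
    · left
      rw [not_lt] at hlt
      have : ((q₀ 0).val + m) % N = (q₀ 0).val + m - N := by
        rw [Nat.mod_eq_sub_mod hlt, Nat.mod_eq_of_lt (by omega)]
      rw [this]; omega
  have hpt : ∀ m : ℕ, m ≤ 2 →
      ‖gridSymbol L M N β (uvSymbolCT L M β μ K Λ) σ (q₀ + m • (fun _ : Fin 1 => (1 : ZMod N))) qv‖ ≤ E := fun m hm =>
    norm_gridSymbol_uvSymbolCT_le_edge hβ hΛ hM σ _ qv (hval m hm)
  have h0 := hpt 0 (by norm_num)
  rw [zero_smul, add_zero] at h0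
  rw [fwdDiff_iter_two_apply]
  calc _ ≤ ‖gridSymbol L M N β (uvSymbolCT L M β μ K Λ) σ (q₀ + 2 • fun _ : Fin 1 => (1 : ZMod N)) qv -
          (2 : ℤ) • gridSymbol L M N β (uvSymbolCT L M β μ K Λ) σ (q₀ + 1 • fun _ : Fin 1 => (1 : ZMod N)) qv‖ +
        ‖gridSymbol L M N β (uvSymbolCT L M β μ K Λ) σ q₀ qv‖ := norm_add_le _ _
    _ ≤ (E + 2 * E) + E := by
        refine add_le_add ((norm_sub_le _ _).trans (add_le_add (hpt 2 le_rfl) ?_)) h0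
        rw [zsmul_eq_mul, norm_mul, Int.cast_ofNat, Complex.norm_ofNat]
        exact mul_le_mul_of_nonneg_left (hpt 1 (by norm_num)) (by norm_num)
    _ = 4 * E := by ring

/-- **In the padding the second time differences vanish**: `2M ≤ val q₀` and `val q₀ + 2 < N` put all three points beyond the window.
[cite: BenfattoGiulianiMastropietro2006, (2.36aa)] -/
theorem fwdDiff_two_time_gridSymbol_uvSymbolCT_eq_zero_of_padding (σ : Fin 2) (q₀ : TorusSite 1 N) (qv : TorusSite 2 L)
    (h1 : 2 * M ≤ (q₀ 0).val) (h2 : (q₀ 0).val + 2 < N) :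
    (fwdDiff (fun _ : Fin 1 => (1 : ZMod N)))^[2] (fun q => gridSymbol L M N β (uvSymbolCT L M β μ K Λ) σ q qv) q₀ = 0 := by
  have hz : ∀ m : ℕ, m ≤ 2 → gridSymbol L M N β (uvSymbolCT L M β μ K Λ) σ (q₀ + m • (fun _ : Fin 1 => (1 : ZMod N))) qv = 0 := by
    intro m hm
    have hv : ¬ ((q₀ + m • (fun _ : Fin 1 => (1 : ZMod N))) 0).val < 2 * M := by
      rw [val_add_smul_timeStep q₀ (by omega), Nat.mod_eq_of_lt (by omega)]; omega
    unfold gridSymbol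
    rw [dif_neg hv]
  have h0 := hz 0 (by norm_num)
  rw [zero_smul, add_zero] at h0
  rw [fwdDiff_iter_two_apply, hz 2 le_rfl, hz 1 (by norm_num), h0]
  simp

end Time

/-! ### The band direction: the continuum frame band along lattice lines -/

/-- **The continuum frame band** `e_K(p) = -2(cos p₁ + cos p₂) - μ - K(p)` on `ℝ²`, whose restriction to the torus momenta `2πk⃗/L` is
`nambuXiCT L μ K` (FST: `e = E - K`). [cite: FeldmanSalmhoferTrubowitz1996, §1 Discussion (E = e + K)] -/
def ctBandFn (μ : ℝ) (K : TrigPolyC4v) (p : Fin 2 → ℝ) : ℝ := -2 * (Real.cos (p 0) + Real.cos (p 1)) - μ - K.eval p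

/-- **The frame band along a lattice line**: `t ↦ e_K(p + t e_l)`. [cite: FeldmanSalmhoferTrubowitz1996, §1 Discussion (E = e + K)] -/
def ctLine (μ : ℝ) (K : TrigPolyC4v) (p : Fin 2 → ℝ) (l : Fin 2) (t : ℝ) : ℝ := ctBandFn μ K (p + t • Pi.single l 1)

/-- **Bounded band geometry along lattice lines** (the hypothesis discharged from `FrameOK` Summits-side): along every lattice line the
frame band has a first and a second derivative bounded by `D`. [cite: FeldmanSalmhoferTrubowitz1998, Lemma 2.1 and eqs. (gzerinit), (wz) (arXiv p.8 L38–41, p.9 L1–75)] -/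
def UVLineBound (μ : ℝ) (K : TrigPolyC4v) (D : ℝ) : Prop :=
  ∀ (p : Fin 2 → ℝ) (l : Fin 2), ∃ e' e'' : ℝ → ℝ,
    (∀ t, HasDerivAt (ctLine μ K p l) (e' t) t) ∧ (∀ t, HasDerivAt e' (e'' t) t) ∧ ∀ t, |e' t| ≤ D ∧ |e'' t| ≤ D

/-- `nambuXiCT` is the restriction of `ctBandFn` to the torus momenta. [cite: BenfattoGiulianiMastropietro2003, §1.1 (ε₀ = ε + δε)] -/
theorem nambuXiCT_eq_ctBandFn [NeZero L] (μ : ℝ) (K : TrigPolyC4v) (k : TorusSite 2 L) :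
    nambuXiCT L μ K k = ctBandFn μ K (latticeMomentum L k) := by
  simp only [nambuXiCT, torusBand, ctBandFn, Fin.sum_univ_two]

/-- The frame band is `(2πℤ)²`-periodic. [cite: BenfattoGiulianiMastropietro2003, §1.1 (ε₀ = ε + δε)] -/
theorem ctBandFn_periodic (μ : ℝ) (K : TrigPolyC4v) (p : Fin 2 → ℝ) (z : Fin 2 → ℤ) :
    ctBandFn μ K (fun i => p i + z i * (2 * Real.pi)) = ctBandFn μ K p := by
  simp only [ctBandFn, TrigPolyC4v.eval_periodic, Real.cos_add_int_mul_two_pi]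

/-- **Translating a torus momentum by `m` steps of `e_l`** moves the lattice momentum by `m·2π/L` along `e_l`, up to `(2πℤ)²`:
`p(k⃗ + m e_l) = p(k⃗) + (m·2π/L) e_l + 2πz`. [cite: BenfattoGiulianiMastropietro2006, §2.1 (2.1)] -/
theorem latticeMomentum_add_smul_single_eq [NeZero L] (k : TorusSite 2 L) (l : Fin 2) (m : ℕ) :
    ∃ z : Fin 2 → ℤ, latticeMomentum L (k + m • (Pi.single l (1 : ZMod L) : TorusSite 2 L)) =
      fun i => (latticeMomentum L k + (m * (2 * Real.pi / L)) • (Pi.single l (1 : ℝ) : Fin 2 → ℝ)) i + z i * (2 * Real.pi) := by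
  have hL : (0 : ℝ) < L := by exact_mod_cast Nat.pos_of_ne_zero (NeZero.ne L)
  refine ⟨fun i => if i = l then -((((k l).val + m) / L : ℕ) : ℤ) else 0, ?_⟩
  funext i
  dsimp only
  by_cases hi : i = l
  · subst hi
    rw [if_pos rfl, nsmul_single_one]
    simp only [latticeMomentum, Pi.add_apply, Pi.single_eq_same, Pi.smul_apply, smul_eq_mul, mul_one, Int.cast_neg,
      Int.cast_natCast]
    rw [ZMod.val_add, ZMod.val_natCast, Nat.add_mod_mod]
    have hdiv := Nat.mod_add_div ((k i).val + m) L
    have hcast : (((((k i).val + m) % L : ℕ)) : ℝ) = ((k i).val : ℝ) + m - (L : ℝ) * ((((k i).val + m) / L : ℕ) : ℝ) := by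
      have : ((((k i).val + m) % L : ℕ) : ℝ) + (L : ℝ) * ((((k i).val + m) / L : ℕ) : ℝ) = ((k i).val : ℝ) + m := by
        exact_mod_cast hdiv
      linarith
    rw [hcast]
    field_simp
    ring
  · rw [if_neg hi]
    have hk : (k + m • (Pi.single l (1 : ZMod L) : TorusSite 2 L)) i = k i := apply_add_smul_single_of_ne k hi m
    simp only [latticeMomentum, hk, Pi.add_apply, Pi.smul_apply, Pi.single_eq_of_ne hi, smul_eq_mul, mul_zero, add_zero,
      Int.cast_zero, zero_mul]

/-- **The frame band at a translated torus momentum is the line function**: `e_K(k⃗ + m e_l) = ctLine μ K p(k⃗) l (m·2π/L)`.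
[cite: BenfattoGiulianiMastropietro2006, §2.1 (2.1)] -/
theorem nambuXiCT_add_smul_single_eq_ctLine [NeZero L] (μ : ℝ) (K : TrigPolyC4v) (k : TorusSite 2 L) (l : Fin 2) (m : ℕ) :
    nambuXiCT L μ K (k + m • (Pi.single l (1 : ZMod L) : TorusSite 2 L)) = ctLine μ K (latticeMomentum L k) l (m * (2 * Real.pi / L)) := by
  obtain ⟨z, hz⟩ := latticeMomentum_add_smul_single_eq k l m
  rw [nambuXiCT_eq_ctBandFn, hz, ctBandFn_periodic, ctLine]

section Space

variable [NeZero L] [NeZero N] {β μ Λ : ℝ} {K : TrigPolyC4v}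

omit [NeZero N] in
/-- **The padded symbol along a lattice line is the restriction of the path function**:
`G(q₀, q⃗ + m e_l) = [val q₀ < 2M]·(βL²)⁻²·(Ψ̂_{ω̃} ∘ ctLine)(m·2π/L)`. [cite: BenfattoGiulianiMastropietro2006, §2.1 (2.3)] -/
theorem gridSymbol_uvSymbolCT_add_smul_eq (hβ : 0 < β) (σ : Fin 2) (q₀ : TorusSite 1 N) (qv : TorusSite 2 L) (l : Fin 2) (m : ℕ) :
    gridSymbol L M N β (uvSymbolCT L M β μ K Λ) σ q₀ (qv + m • (Pi.single l (1 : ZMod L) : TorusSite 2 L)) =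
      if (q₀ 0).val < 2 * M then ((1 / (β * (L : ℝ) ^ 2) : ℝ) : ℂ) ^ 2 *
        uvPathFn (β * (L : ℝ) ^ 2) Λ (gridFreq M N β q₀) (ctLine μ K (latticeMomentum L qv) l) (m * (2 * Real.pi / L)) else 0 := by
  rw [gridSymbol_uvSymbolCT_eq hβ]
  split_ifs with h
  · rw [uvSymbolFn_eq_uvSymbolFnXi, uvPathFn, nambuXiCT_add_smul_single_eq_ctLine]
  · rfl

omit [NeZero N] in
/-- **The second space difference of the padded symbol is the second difference of the path function** at step `2π/L`.
[cite: BenfattoGiulianiMastropietro2006, (2.36aa)] -/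
theorem fwdDiff_two_space_gridSymbol_uvSymbolCT_eq (hβ : 0 < β) (σ : Fin 2) (q₀ : TorusSite 1 N) (qv : TorusSite 2 L) (l : Fin 2) :
    (fwdDiff (Pi.single l (1 : ZMod L) : TorusSite 2 L))^[2] (gridSymbol L M N β (uvSymbolCT L M β μ K Λ) σ q₀) qv =
      if (q₀ 0).val < 2 * M then ((1 / (β * (L : ℝ) ^ 2) : ℝ) : ℂ) ^ 2 *
        (uvPathFn (β * (L : ℝ) ^ 2) Λ (gridFreq M N β q₀) (ctLine μ K (latticeMomentum L qv) l) (0 + 2 * (2 * Real.pi / L)) -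
          (2 : ℝ) • uvPathFn (β * (L : ℝ) ^ 2) Λ (gridFreq M N β q₀) (ctLine μ K (latticeMomentum L qv) l) (0 + 2 * Real.pi / L) +
          uvPathFn (β * (L : ℝ) ^ 2) Λ (gridFreq M N β q₀) (ctLine μ K (latticeMomentum L qv) l) 0) else 0 := by
  have h0 := gridSymbol_uvSymbolCT_add_smul_eq (μ := μ) (K := K) (Λ := Λ) (M := M) hβ σ q₀ qv l 0
  rw [zero_smul, add_zero] at h0
  rw [fwdDiff_iter_two_apply, gridSymbol_uvSymbolCT_add_smul_eq hβ, gridSymbol_uvSymbolCT_add_smul_eq hβ, h0]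
  split_ifs with h
  · push_cast
    rw [Complex.real_smul, zero_add, zero_add, one_mul, zero_mul]
    push_cast
    ring
  · simp

omit [NeZero N] in
/-- **Space bound**: under `UVLineBound μ K D`,
`‖(Δ_{e_l})² G(q₀,·)(q⃗)‖ ≤ (βL²)⁻²·(2π/L)²·(D²(4B₂+6B₁+2)·2/Λ + D(2B₁+1))·βL²/max(|ω̃_{q₀}|, Λ/2)²` (mean value twice along the line; zero
beyond the window). [cite: BenfattoGiulianiMastropietro2006, (2.36aa)] -/
theorem norm_fwdDiff_two_space_gridSymbol_uvSymbolCT_le (hβ : 0 < β) (hΛ : 0 < Λ) {B₁ B₂ : ℝ}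
    (hB₁ : ∀ x, |deriv salmhoferCutoff x| ≤ B₁) (hB₂ : ∀ x, |deriv (deriv salmhoferCutoff) x| ≤ B₂) {D : ℝ} (hD : 0 ≤ D)
    (hline : UVLineBound μ K D) (σ : Fin 2) (q₀ : TorusSite 1 N) (qv : TorusSite 2 L) (l : Fin 2) :
    ‖(fwdDiff (Pi.single l (1 : ZMod L) : TorusSite 2 L))^[2] (gridSymbol L M N β (uvSymbolCT L M β μ K Λ) σ q₀) qv‖ ≤
      (1 / (β * (L : ℝ) ^ 2)) ^ 2 * ((2 * Real.pi / L) ^ 2 *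
        ((D ^ 2 * (4 * B₂ + 6 * B₁ + 2) * (2 / Λ) + D * (2 * B₁ + 1)) * (β * (L : ℝ) ^ 2) / max |gridFreq M N β q₀| (Λ / 2) ^ 2)) := by
  have hL : (0 : ℝ) < L := by exact_mod_cast Nat.pos_of_ne_zero (NeZero.ne L)
  have hB10 : 0 ≤ B₁ := (abs_nonneg _).trans (hB₁ 0)
  have hB20 : 0 ≤ B₂ := (abs_nonneg _).trans (hB₂ 0)
  have hRHS : 0 ≤ (1 / (β * (L : ℝ) ^ 2)) ^ 2 * ((2 * Real.pi / L) ^ 2 *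
      ((D ^ 2 * (4 * B₂ + 6 * B₁ + 2) * (2 / Λ) + D * (2 * B₁ + 1)) * (β * (L : ℝ) ^ 2) / max |gridFreq M N β q₀| (Λ / 2) ^ 2)) := by
    have := uvEnv_pos hΛ (gridFreq M N β q₀)
    positivity
  rw [fwdDiff_two_space_gridSymbol_uvSymbolCT_eq hβ]
  split_ifs with h
  · set c := β * (L : ℝ) ^ 2 with hc
    set ω := gridFreq M N β q₀ with hω
    set path := ctLine μ K (latticeMomentum L qv) l with hpath
    obtain ⟨e', e'', he', he'', hbd⟩ := hline (latticeMomentum L qv) l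
    rw [norm_mul, norm_pow, Complex.norm_real, Real.norm_eq_abs, abs_of_nonneg (by positivity)]
    refine mul_le_mul_of_nonneg_left ?_ (by positivity)
    have h2 := Literature.Analysis.norm_second_difference_le (f := uvPathFn c Λ ω path) (x := 0) (δ := 2 * Real.pi / L)
      (by positivity) (fun t _ => hasDerivAt_uvPathFn (c := c) (ω := ω) hΛ (he' t))
      (fun t _ => hasDerivAt_uvPathFnD1 (c := c) (ω := ω) hΛ (he' t) (he'' t))
      (fun t _ => norm_uvPathFnD2_le (c := c) (ω := ω) hΛ (by positivity) hB₁ hB₂ hD (hbd t).1 (hbd t).2)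
    exact h2
  · rw [norm_zero]; exact hRHS

end Space

/-! ### The `ℓ²` sums -/

section Sums

variable [NeZero L] [NeZero N] {β μ Λ : ℝ} {K : TrigPolyC4v}

omit [NeZero N] in
/-- The number of torus momenta: `#(ℤ/L)² = L²` (local copy of `TorusCooperSum.card_torusSite_two`). [folklore] -/
private theorem card_torusSite_two' : Fintype.card (TorusSite 2 L) = L ^ 2 := by
  rw [Fintype.card_fun, ZMod.card, Fintype.card_fin]

/-- **Window sums are Matsubara sums**: `Σ_{q₀} Σ_{q⃗} [val q₀ < 2M]·f(ω̃_{q₀}) = L²·Σ_i f(ω_i)` (`2M ≤ N`).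
[cite: BenfattoGiulianiMastropietro2006, §2.1 (2.3)] -/
theorem sum_sum_window_eq (hMN : 2 * M ≤ N) (β : ℝ) (f : ℝ → ℝ) :
    ∑ q₀ : TorusSite 1 N, ∑ _qv : TorusSite 2 L, (if (q₀ 0).val < 2 * M then f (gridFreq M N β q₀) else 0) =
      (L : ℝ) ^ 2 * ∑ i : MatsubaraIdx M, f (matsubaraFreq β M i) := by
  have h := sum_freqMomentum_eq_sum_gridTorus (L := L) (N := N) hMN (fun k : FreqMomentum L M => f (matsubaraFreq β M k.1))
  rw [Fintype.sum_prod_type] at h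
  simp only [sum_const, card_univ, card_torusSite_two', nsmul_eq_mul, Nat.cast_pow] at h
  simp_rw [sum_const, card_univ, card_torusSite_two', nsmul_eq_mul, Nat.cast_pow]
  rw [mul_sum, h]
  refine sum_congr rfl fun q₀ _ => ?_
  split_ifs with hq
  · rw [matsubaraFreq_eq_gridFreq β q₀ hq]
  · simp

/-- **The `ℓ²` norm of the padded ultraviolet symbol**: `Σ_{q₀,q⃗} ‖G‖² ≤ L²·(βL²)⁻²·2β/Λ` (`0 < β`, `0 < Λ`, `2M ≤ N`).
[cite: BenfattoGiulianiMastropietro2006, §2.8 (2.80)] -/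
theorem sum_norm_sq_gridSymbol_uvSymbolCT_le (hβ : 0 < β) (hΛ : 0 < Λ) (hMN : 2 * M ≤ N) (σ : Fin 2) :
    ∑ q₀ : TorusSite 1 N, ∑ qv : TorusSite 2 L, ‖gridSymbol L M N β (uvSymbolCT L M β μ K Λ) σ q₀ qv‖ ^ 2 ≤
      (L : ℝ) ^ 2 * ((1 / (β * (L : ℝ) ^ 2)) ^ 2 * (2 * β / Λ)) := by
  have hpt : ∀ (q₀ : TorusSite 1 N) (qv : TorusSite 2 L), ‖gridSymbol L M N β (uvSymbolCT L M β μ K Λ) σ q₀ qv‖ ^ 2 ≤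
      if (q₀ 0).val < 2 * M then (1 / (β * (L : ℝ) ^ 2)) ^ 2 * (1 / max |gridFreq M N β q₀| (Λ / 2) ^ (2 * 0 + 2)) else 0 := by
    intro q₀ qv
    split_ifs with hq
    · have h := norm_gridSymbol_uvSymbolCT_le (M := M) (N := N) hβ μ K hΛ σ q₀ qv
      have hm := uvEnv_pos hΛ (gridFreq M N β q₀)
      calc ‖gridSymbol L M N β (uvSymbolCT L M β μ K Λ) σ q₀ qv‖ ^ 2
          ≤ ((1 / (β * (L : ℝ) ^ 2)) ^ 2 * ((β * (L : ℝ) ^ 2) / max |gridFreq M N β q₀| (Λ / 2))) ^ 2 :=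
            pow_le_pow_left₀ (norm_nonneg _) h 2
        _ = (1 / (β * (L : ℝ) ^ 2)) ^ 2 * (1 / max |gridFreq M N β q₀| (Λ / 2) ^ (2 * 0 + 2)) := by
            field_simp
    · rw [gridSymbol_uvSymbolCT_eq hβ, if_neg hq, norm_zero, zero_pow two_ne_zero]
  refine (sum_le_sum fun q₀ _ => sum_le_sum fun qv _ => hpt q₀ qv).trans ?_
  rw [sum_sum_window_eq hMN β (fun ω => (1 / (β * (L : ℝ) ^ 2)) ^ 2 * (1 / max |ω| (Λ / 2) ^ (2 * 0 + 2))), ← mul_sum]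
  refine mul_le_mul_of_nonneg_left (mul_le_mul_of_nonneg_left ?_ (by positivity)) (by positivity)
  simpa using sum_inv_uvEnv_pow_le hβ hΛ M 0

/-- **The `ℓ²` norm of the second SPACE differences**: under `UVLineBound μ K D`,
`Σ_{q₀,q⃗} ‖(Δ_{e_l})² G‖² ≤ L²·(βL²)⁻²·(2π/L)⁴·K_x²·(2/Λ)²·2β/Λ`, `K_x = D²(4B₂+6B₁+2)·2/Λ + D(2B₁+1)`.
[cite: BenfattoGiulianiMastropietro2006, §2.8 (2.80)] -/
theorem sum_norm_sq_fwdDiff_two_space_uvSymbolCT_le (hβ : 0 < β) (hΛ : 0 < Λ) {B₁ B₂ : ℝ}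
    (hB₁ : ∀ x, |deriv salmhoferCutoff x| ≤ B₁) (hB₂ : ∀ x, |deriv (deriv salmhoferCutoff) x| ≤ B₂) {D : ℝ} (hD : 0 ≤ D)
    (hline : UVLineBound μ K D) (hMN : 2 * M ≤ N) (σ : Fin 2) (l : Fin 2) :
    ∑ q₀ : TorusSite 1 N, ∑ qv : TorusSite 2 L,
        ‖(fwdDiff (Pi.single l (1 : ZMod L) : TorusSite 2 L))^[2] (gridSymbol L M N β (uvSymbolCT L M β μ K Λ) σ q₀) qv‖ ^ 2 ≤
      (L : ℝ) ^ 2 * ((1 / (β * (L : ℝ) ^ 2)) ^ 2 * (2 * Real.pi / L) ^ 4 *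
        (D ^ 2 * (4 * B₂ + 6 * B₁ + 2) * (2 / Λ) + D * (2 * B₁ + 1)) ^ 2 * ((2 / Λ) ^ (2 * 1) * (2 * β / Λ))) := by
  set Kx := D ^ 2 * (4 * B₂ + 6 * B₁ + 2) * (2 / Λ) + D * (2 * B₁ + 1) with hKx
  have hpt : ∀ (q₀ : TorusSite 1 N) (qv : TorusSite 2 L),
      ‖(fwdDiff (Pi.single l (1 : ZMod L) : TorusSite 2 L))^[2] (gridSymbol L M N β (uvSymbolCT L M β μ K Λ) σ q₀) qv‖ ^ 2 ≤
        if (q₀ 0).val < 2 * M then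
          (1 / (β * (L : ℝ) ^ 2)) ^ 2 * (2 * Real.pi / L) ^ 4 * Kx ^ 2 * (1 / max |gridFreq M N β q₀| (Λ / 2) ^ (2 * 1 + 2)) else 0 := by
    intro q₀ qv
    split_ifs with hq
    · have h := norm_fwdDiff_two_space_gridSymbol_uvSymbolCT_le (M := M) (N := N) hβ hΛ hB₁ hB₂ hD hline σ q₀ qv l
      have hm := uvEnv_pos hΛ (gridFreq M N β q₀)
      refine (pow_le_pow_left₀ (norm_nonneg _) h 2).trans (le_of_eq ?_)
      rw [← hKx]
      field_simp
    · rw [fwdDiff_two_space_gridSymbol_uvSymbolCT_eq hβ, if_neg hq, norm_zero, zero_pow two_ne_zero]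
  refine (sum_le_sum fun q₀ _ => sum_le_sum fun qv _ => hpt q₀ qv).trans ?_
  rw [sum_sum_window_eq hMN β (fun ω => (1 / (β * (L : ℝ) ^ 2)) ^ 2 * (2 * Real.pi / L) ^ 4 * Kx ^ 2 *
    (1 / max |ω| (Λ / 2) ^ (2 * 1 + 2))), ← mul_sum]
  exact mul_le_mul_of_nonneg_left (mul_le_mul_of_nonneg_left (sum_inv_uvEnv_pow_le hβ hΛ M 1) (by positivity))
    (by positivity)

/-- **The edge set of the time direction has at most four points**: `{q₀ : 2M ≤ val q₀ + 2, ¬(2M ≤ val q₀ ∧ val q₀ + 2 < N)}` injects by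
`val` into `{2M-2, 2M-1, N-2, N-1}`. [cite: Salmhofer1999, §4.2.4 (4.63)] -/
theorem card_timeEdge_le_four :
    ((univ : Finset (TorusSite 1 N)).filter fun q₀ =>
        2 * M ≤ (q₀ 0).val + 2 ∧ ¬ (2 * M ≤ (q₀ 0).val ∧ (q₀ 0).val + 2 < N)).card ≤ 4 := by
  classical
  set E := (univ : Finset (TorusSite 1 N)).filter fun q₀ =>
    2 * M ≤ (q₀ 0).val + 2 ∧ ¬ (2 * M ≤ (q₀ 0).val ∧ (q₀ 0).val + 2 < N) with hE
  have hinj : Set.InjOn (fun q₀ : TorusSite 1 N => (q₀ 0).val) E := fun q _ q' _ h =>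
    torusSite_one_ext (ZMod.val_injective _ h)
  have hsub : E.image (fun q₀ : TorusSite 1 N => (q₀ 0).val) ⊆ {2 * M - 2, 2 * M - 1, N - 2, N - 1} := by
    intro v hv
    obtain ⟨q₀, hq₀, rfl⟩ := mem_image.1 hv
    have h1 := (mem_filter.1 hq₀).2
    have hlt := (q₀ 0).val_lt
    simp only [mem_insert, mem_singleton]
    omega
  calc E.card = (E.image fun q₀ : TorusSite 1 N => (q₀ 0).val).card := (card_image_of_injOn hinj).symm
    _ ≤ ({2 * M - 2, 2 * M - 1, N - 2, N - 1} : Finset ℕ).card := card_le_card hsub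
    _ ≤ 4 := by
        refine (card_insert_le _ _).trans ?_
        refine (Nat.succ_le_succ (card_insert_le _ _)).trans ?_
        refine (Nat.succ_le_succ (Nat.succ_le_succ (card_insert_le _ _))).trans ?_
        rw [card_singleton]

/-- **The `ℓ²` norm of the second TIME differences** (`0 < β`, `0 < Λ`, `2 ≤ M`, `2M ≤ N`): interior part
`L²·(βL²)⁻²·(2π/β)⁴·(4B₂+6B₁+2)²·[64·(2/Λ)⁴·2β/Λ + (2/Λ)⁶·64π]` plus the four edge points `4·L²·(4·(βL²)⁻¹·β/(π(2M-3)))²` — the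
only place where the sharp Matsubara truncation is visible, and it is `O(β²/M²)`. [cite: BenfattoGiulianiMastropietro2006, §2.8 (2.80)] -/
theorem sum_norm_sq_fwdDiff_two_time_uvSymbolCT_le (hβ : 0 < β) (hΛ : 0 < Λ) {B₁ B₂ : ℝ}
    (hB₁ : ∀ x, |deriv salmhoferCutoff x| ≤ B₁) (hB₂ : ∀ x, |deriv (deriv salmhoferCutoff) x| ≤ B₂) (hM : 2 ≤ M)
    (hMN : 2 * M ≤ N) (σ : Fin 2) :
    ∑ q₀ : TorusSite 1 N, ∑ qv : TorusSite 2 L,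
        ‖(fwdDiff (fun _ : Fin 1 => (1 : ZMod N)))^[2] (fun q => gridSymbol L M N β (uvSymbolCT L M β μ K Λ) σ q qv) q₀‖ ^ 2 ≤
      (L : ℝ) ^ 2 * ((1 / (β * (L : ℝ) ^ 2)) ^ 2 * (2 * Real.pi / β) ^ 4 * (4 * B₂ + 6 * B₁ + 2) ^ 2 *
          (64 * ((2 / Λ) ^ 4 * (2 * β / Λ)) + (2 / Λ) ^ 6 * (64 * Real.pi))) +
        4 * ((L : ℝ) ^ 2 * (4 * ((1 / (β * (L : ℝ) ^ 2)) ^ 2 * ((β * (L : ℝ) ^ 2) * (β / (Real.pi * (2 * M - 3)))))) ^ 2) := by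
  classical
  set c := β * (L : ℝ) ^ 2 with hc
  set K₂ := 4 * B₂ + 6 * B₁ + 2 with hK
  set Eb := 4 * ((1 / c) ^ 2 * (c * (β / (Real.pi * (2 * M - 3))))) with hEb
  set Edge := (univ : Finset (TorusSite 1 N)).filter fun q₀ =>
    2 * M ≤ (q₀ 0).val + 2 ∧ ¬ (2 * M ≤ (q₀ 0).val ∧ (q₀ 0).val + 2 < N) with hEdge
  set F : TorusSite 1 N → TorusSite 2 L → ℂ := fun q₀ qv =>
    (fwdDiff (fun _ : Fin 1 => (1 : ZMod N)))^[2] (fun q => gridSymbol L M N β (uvSymbolCT L M β μ K Λ) σ q qv) q₀ with hF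
  -- pointwise: interior envelope + edge indicator
  have hpt : ∀ (q₀ : TorusSite 1 N) (qv : TorusSite 2 L), ‖F q₀ qv‖ ^ 2 ≤
      (if (q₀ 0).val < 2 * M then (1 / c) ^ 2 * (2 * Real.pi / β) ^ 4 * K₂ ^ 2 *
          (1 / max (|gridFreq M N β q₀| - 2 * (2 * Real.pi / β)) (Λ / 2) ^ 6) else 0) +
        (if q₀ ∈ Edge then Eb ^ 2 else 0) := by
    intro q₀ qv
    have hms : 0 < max (|gridFreq M N β q₀| - 2 * (2 * Real.pi / β)) (Λ / 2) := lt_max_of_lt_right (by positivity)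
    by_cases hint : (q₀ 0).val + 2 < 2 * M
    · have h := norm_fwdDiff_two_time_gridSymbol_uvSymbolCT_le_interior (μ := μ) (K := K) (Λ := Λ) hβ hΛ hB₁ hB₂ hMN σ q₀ qv hint
      rw [if_pos (show (q₀ 0).val < 2 * M by omega)]
      refine le_add_of_le_of_nonneg ((pow_le_pow_left₀ (norm_nonneg _) h 2).trans (le_of_eq ?_)) (by split_ifs <;> positivity)
      rw [← hc, ← hK]
      field_simp
    · by_cases hpad : 2 * M ≤ (q₀ 0).val ∧ (q₀ 0).val + 2 < N
      · have h0 := fwdDiff_two_time_gridSymbol_uvSymbolCT_eq_zero_of_padding (β := β) (μ := μ) (K := K) (Λ := Λ) (M := M) σ q₀ qv hpad.1 hpad.2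
        rw [hF]; dsimp only; rw [h0, norm_zero, zero_pow two_ne_zero]
        exact add_nonneg (by split_ifs <;> positivity) (by split_ifs <;> positivity)
      · have hmem : q₀ ∈ Edge := mem_filter.2 ⟨mem_univ _, by omega, hpad⟩
        have h := norm_fwdDiff_two_time_gridSymbol_uvSymbolCT_le_edge (μ := μ) (K := K) (Λ := Λ) hβ hΛ hM hMN σ q₀ qv (by omega)
        rw [if_pos hmem]
        refine le_add_of_nonneg_of_le (by split_ifs <;> positivity) ?_
        rw [hEb, hc]
        exact pow_le_pow_left₀ (norm_nonneg _) h 2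
  refine (sum_le_sum fun q₀ _ => sum_le_sum fun qv _ => hpt q₀ qv).trans ?_
  simp only [sum_add_distrib]
  refine add_le_add ?_ ?_
  · rw [sum_sum_window_eq hMN β (fun ω => (1 / c) ^ 2 * (2 * Real.pi / β) ^ 4 * K₂ ^ 2 *
      (1 / max (|ω| - 2 * (2 * Real.pi / β)) (Λ / 2) ^ 6)), ← mul_sum]
    have hB10 : 0 ≤ B₁ := (abs_nonneg _).trans (hB₁ 0)
    have hB20 : 0 ≤ B₂ := (abs_nonneg _).trans (hB₂ 0)
    exact mul_le_mul_of_nonneg_left (mul_le_mul_of_nonneg_left (sum_inv_uvEnvShift_pow_six_le hβ hΛ M) (by positivity))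
      (by positivity)
  · -- the edge: at most four points, each row of `L²` momenta
    have hrow : ∀ q₀ : TorusSite 1 N, ∑ _qv : TorusSite 2 L, (if q₀ ∈ Edge then Eb ^ 2 else (0 : ℝ)) =
        if q₀ ∈ Edge then (L : ℝ) ^ 2 * Eb ^ 2 else 0 := by
      intro q₀
      split_ifs
      · rw [sum_const, card_univ, card_torusSite_two', nsmul_eq_mul, Nat.cast_pow]
      · simp
    simp_rw [hrow]
    rw [← sum_filter, Finset.filter_mem_eq_inter, Finset.univ_inter, sum_const, nsmul_eq_mul]
    have hcard : (Edge.card : ℝ) ≤ 4 := by exact_mod_cast card_timeEdge_le_four (M := M) (N := N)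
    have : (0 : ℝ) ≤ (L : ℝ) ^ 2 * Eb ^ 2 := by positivity
    calc (Edge.card : ℝ) * ((L : ℝ) ^ 2 * Eb ^ 2) ≤ 4 * ((L : ℝ) ^ 2 * Eb ^ 2) := mul_le_mul_of_nonneg_right hcard this
      _ = _ := by rw [hEb, hc]

end Sums

end Literature.MathematicalPhysics.QuantumLattice

end
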